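import Literature.AnabelianGeometry.EtaleTheta.Discharge.Sec1DeltaThetaCommutatorQuotient
import Literature.AnabelianGeometry.EtaleTheta.Discharge.Sec1FreeTwoHeisenbergZHat
import HarnessLib

/-!
# [EtTh] §1 p. 12: "`(Ẑ(1) ≅) Δ_Θ`" — the tempered `Δ_Θ` and `l·Δ_Θ` of the §1 theta setting ARE `Ẑ`
# (proof-only; GAP-LEDGER row G-w4d021-1 at the L2 level, modulo the §2-chain binder `hYcl`)

Mochizuki, *The étale theta function and its Frobenioid-theoretic manifestations*, Publ. RIMS **45**
(2009) [EtTh], §1, PRIMS PDF p. 12 (printed 238): "`1 → ∧² Δ^ell_X (≅ Ẑ(1)) → Δ^Θ_X → Δ^ell_X → 1` …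
`(Ẑ(1) ≅) Δ_Θ ⊆ Δ^Θ_X`" [cite: MochizukiEtTh2009, §1 p.12]. Layer L2 of the abc-iut cell, seat
abc-iut-L2-d1 (gen 3); PROOF-ONLY composition of
* the pure profinite core `[Δ_X,Δ_X]⁻/[[Δ_X,Δ_X],Δ_X]⁻ ≅ Ẑ` for the free profinite `Δ_X`
  (`IsEtThOrigin.exists_hom_commutatorClosure_zHat`, `Sec1FreeTwoHeisenbergZHat.lean`, abc-iut-w5-d171), and
* the tempered transport `Δ_Θ ≃* (any model of that quotient)` under the closedness binder `hYcl`
  (`nonempty_deltaTheta_mulEquiv_of_commutatorQuotient`, `Sec1DeltaThetaCommutatorQuotient.lean`, this seat).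

WHAT IS PROVED (for `D : ThetaSetting p`, guard `hO : D.IsEtThOrigin` = "`Δ_X` is a profinite free group on
2 generators", binder `hYcl` = "the image of `Δ^tp_Y` in `Δ^Θ_X` is closed", GAP-LEDGER row G-w4d021-2):
* `ThetaSetting.IsEtThOrigin.nonempty_deltaTheta_mulEquiv_zHat` — `Δ_Θ ≃* Ẑ`;
* `ThetaSetting.IsEtThOrigin.nonempty_lDeltaTheta_mulEquiv_zHat` — `l·Δ_Θ ≃* Ẑ` for `l ≠ 0`.
Here `Ẑ = SemiGraphs.ZHat` = Mathlib's `ProfiniteGrp.ProfiniteCompletion.completion` of `ℤ`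
(= `IUT.HodgeTheaters.ZHat` by `rfl`). The model-level form "`(l·Δ_Θ)(M) ≅ Ẑ(1)`" for
`ModelCyclotomes.lDeltaQuot (C.rigidData …)` is the sequel `IUT/HodgeArakelov/ModelCyclotomesZHat.lean`.
HONEST FRAMING: group structure only (the Tate twist "(1)" is NOT claimed); [EtTh] is refereed; the theta
setting is data quoting print, not asserted to exist; no side taken on [IUTchIII] Cor. 3.12. `hYcl` is NOT
derivable from `Setting.lean` v3 (finer-topology / discrete-image models) and stays an explicit hypothesis.
-/

noncomputable section

namespace Literature.AnabelianGeometry.EtaleTheta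

open Literature.AnabelianGeometry.SemiGraphs
open scoped commutatorElement

namespace ThetaSetting

variable {p : ℕ} [Fact p.Prime] {D : ThetaSetting p}

/-- **"`(Ẑ(1) ≅) Δ_Θ`"** ([EtTh] p. 12): under the freeness guard `IsEtThOrigin` and the closedness
binder `hYcl` ("(Δ^tp_Y)^Θ is profinite", pp. 12–13), the tempered `Δ_Θ = Ker((Π^tp_X)^Θ ↠ (Π^tp_X)^ell)`
of the §1 theta setting is isomorphic, as an abstract group, to `Ẑ` (the profinite completion of `ℤ`).
[cite: MochizukiEtTh2009, §1 p.12] -/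
theorem IsEtThOrigin.nonempty_deltaTheta_mulEquiv_zHat (hO : D.IsEtThOrigin)
    (hYcl : (D.DtpY.map D.toHat.toMonoidHom).topologicalClosure ≤
      D.DtpY.map D.toHat.toMonoidHom ⊔ (⁅⁅D.DeltaHat, D.DeltaHat⁆, D.DeltaHat⁆).topologicalClosure) :
    Nonempty (↥D.DeltaTheta ≃* ZHat) := by
  obtain ⟨a, b, φ, -, hφs, hφk, -⟩ := hO.exists_hom_commutatorClosure_zHat
  exact D.nonempty_deltaTheta_mulEquiv_of_commutatorQuotient hO hYcl φ hφs hφk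

/-- **`l·Δ_Θ ≅ Ẑ`** for `l ≠ 0` ([EtTh] p. 12 "`(Ẑ(1) ≅) Δ_Θ`", Prop. 2.12 (i) p. 45 "`l · Δ_Θ`"): same
hypotheses; `l·Δ_Θ ≃* Δ_Θ` by torsion-freeness. [cite: MochizukiEtTh2009, §1 p.12] -/
theorem IsEtThOrigin.nonempty_lDeltaTheta_mulEquiv_zHat (hO : D.IsEtThOrigin)
    (hYcl : (D.DtpY.map D.toHat.toMonoidHom).topologicalClosure ≤
      D.DtpY.map D.toHat.toMonoidHom ⊔ (⁅⁅D.DeltaHat, D.DeltaHat⁆, D.DeltaHat⁆).topologicalClosure)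
    {l : ℕ} (hl : l ≠ 0) :
    Nonempty (↥(D.lDeltaTheta l) ≃* ZHat) := by
  obtain ⟨a, b, φ, -, hφs, hφk, -⟩ := hO.exists_hom_commutatorClosure_zHat
  exact D.nonempty_lDeltaTheta_mulEquiv_of_commutatorQuotient hO hYcl hl φ hφs hφk

end ThetaSetting

end Literature.AnabelianGeometry.EtaleTheta

end
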